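import Summits.QuantumFields.YangMills.Theorems.LuscherReductionTwistedTraceScalingBTTails
import Summits.QuantumFields.YangMills.Theorems.LuscherReductionTwistedTraceScalingBTWindow
import Summits.QuantumFields.YangMills.Theorems.LuscherReductionTwistedTraceScalingBTHaarFloor
import HarnessLib

/-!
# The CORE KERNEL FLOOR at the diagonal vacuum pair: on `supp Ω × supp Ω × G_c(ρ)` the kernel is `≥ e^{2β|E|}·e^{−β|E|(2ρ + √2‖v̂‖ + √2‖v̂'‖)²}·e^{−β/2(S + S')}` with
# `S(oT 1 v) ≤ 100N_P‖v̂‖² + E(t,0)`, and `K₁^{(L³β)}(1,1) = e^{2β|E|}`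
# (lane A of S-BASE, crux `TwistedTraceScaling` stmt-QuantumFields-20203, C4-CORE, the (B-T) pen; design note `pub/ym-fleet/ym-luscher-20007-p1/COARSE-DESIGN.md` §25.9 (floor))

* `kinDefect_orthoTube_one_le` — for `g ∈ G_c(ρ)` and capped fibres: `kinDefect (oT 1 v) (oT 1 v') g ≤ |E|·(2ρ + √2‖v̂‖ + √2‖v̂'‖)²` (`Δ_e = q(U)(q(g_y) − 1) − (q(g_x) − 1)q(V) + (q(U) − q(V))`);
* `wilsonAction_orthoTube_one_le` — `S(oT 1 v) ≤ (10√N_P‖v̂‖)² + E(t,0)` (`…BTTubeMagnetic.wilsonAction_orthoTube_le` at `u = 1`, `S₁(1) = 0`, `norm_covCurl_le_op`);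
* ★★ `transferKernel_orthoTube_one_ge` — the pointwise floor; `transferKernel_one_site_one_one_cube` — `K₁^{(L³β)}(1,1) = exp(β·2|E|)` (so the floor is RELATIVE to the one-site diagonal);
* ★★ `fpBOKernel_one_one_ge` — with `W ≥ 𝟙_{G_c(ρ)}`: `fpBOKernel β Ω W 1 1 ≥ m(β,ρ,R,t)·Haar^Λ(G_c(ρ))·(∫Ω dπ)²` for `supp Ω ⊆ {‖v̂‖ ≤ R, |v_{e,c}| ≤ t}` (`…BTTails.fpBOKernel_ge_of_kernel_ge`).
HONEST FRAMING: bookkeeping for a stub of a child of the CONDITIONAL reduction route R2b1; top-value floor, rates and assembly OPEN; C4-CORE OPEN; not infinite volume, not a gap, not Clay.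
-/

set_option autoImplicit false

noncomputable section

open MeasureTheory Filter Topology Real
open scoped BigOperators Matrix Quaternion
open Literature.MathematicalPhysics.QuantumFieldTheory
open Literature.MathematicalPhysics.QuantumLattice

namespace Summit.QuantumFields.YangMills.Theorems.FemtoTransferGap.TwoLattice.ConstTube

open Summit.QuantumFields.YangMills.Theorems.FemtoTransferGap
open Summit.QuantumFields.YangMills.Theorems.FemtoTransferGap.TwoLattice
open Summit.QuantumFields.YangMills.Theorems.FemtoTransferGap.TwoLattice.Avg
open Summit.QuantumFields.YangMills.Theorems.FemtoTransferGap.TwoLattice.Stiff (LinkSpace)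
open Summit.QuantumFields.YangMills.Theorems.FemtoTransferGap.TwoLattice.Cov

variable {L : ℕ} [NeZero L]

/-! ## §1 The defect near the vacuum pair -/

/-- On the core with capped fibres: `kinDefect (oT 1 v) (oT 1 v') g ≤ |E|·(2ρ + √2‖v̂‖ + √2‖v̂'‖)²`. [folklore] -/
theorem kinDefect_orthoTube_one_le {v v' : Edge 3 L → Fin 3 → ℝ} (hv1 : ∀ e, ∑ a, v e a ^ 2 ≤ 1) (hv'1 : ∀ e, ∑ a, v' e a ^ 2 ≤ 1) {ρ : ℝ} {g : Site 3 L → SU2}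
    (hg : g ∈ gaugeCore L ρ) :
    kinDefect L (orthoTube L 1 v) (orthoTube L 1 v') g ≤
      (Fintype.card (Edge 3 L) : ℝ) * (2 * ρ + Real.sqrt 2 * ‖linkEmbed L v‖ + Real.sqrt 2 * ‖linkEmbed L v'‖) ^ 2 := by
  have hρ0 : 0 ≤ ρ := (norm_nonneg _).trans (hg 0)
  have hm0 : 0 ≤ 2 * ρ + Real.sqrt 2 * ‖linkEmbed L v‖ + Real.sqrt 2 * ‖linkEmbed L v'‖ := by positivity
  have he : ∀ e : Edge 3 L, ‖su2Quat (orthoTube L 1 v e) * su2Quat (g (e.1.shift e.2)) - su2Quat (g e.1) * su2Quat (orthoTube L 1 v' e)‖ ≤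
      2 * ρ + Real.sqrt 2 * ‖linkEmbed L v‖ + Real.sqrt 2 * ‖linkEmbed L v'‖ := fun e => by
    have eq : su2Quat (orthoTube L 1 v e) * su2Quat (g (e.1.shift e.2)) - su2Quat (g e.1) * su2Quat (orthoTube L 1 v' e) =
        su2Quat (orthoTube L 1 v e) * (su2Quat (g (e.1.shift e.2)) - 1) - (su2Quat (g e.1) - 1) * su2Quat (orthoTube L 1 v' e) +
          (su2Quat (orthoTube L 1 v e) - su2Quat (orthoTube L 1 v' e)) := by noncomm_ring
    rw [eq]
    have h1 : ‖su2Quat (orthoTube L 1 v e) * (su2Quat (g (e.1.shift e.2)) - 1)‖ ≤ ρ := by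
      rw [norm_mul, norm_su2Quat, one_mul]; exact hg _
    have h2 : ‖(su2Quat (g e.1) - 1) * su2Quat (orthoTube L 1 v' e)‖ ≤ ρ := by
      rw [norm_mul, norm_su2Quat, mul_one]; exact hg _
    have h3 := norm_su2Quat_orthoTube_sub_orthoTube_le (1 : GaugeConfig 3 1 SU2) 1 hv1 hv'1 e
    rw [sub_self, norm_zero, add_zero] at h3
    have t1 := norm_add_le (su2Quat (orthoTube L 1 v e) * (su2Quat (g (e.1.shift e.2)) - 1) - (su2Quat (g e.1) - 1) * su2Quat (orthoTube L 1 v' e))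
      (su2Quat (orthoTube L 1 v e) - su2Quat (orthoTube L 1 v' e))
    have t2 := norm_sub_le (su2Quat (orthoTube L 1 v e) * (su2Quat (g (e.1.shift e.2)) - 1)) ((su2Quat (g e.1) - 1) * su2Quat (orthoTube L 1 v' e))
    linarith
  unfold kinDefect
  refine (Finset.sum_le_sum fun e _ => pow_le_pow_left₀ (norm_nonneg _) (he e) 2).trans ?_
  rw [Finset.sum_const, Finset.card_univ, nsmul_eq_mul]

/-! ## §2 The action of a tube point over the vacuum -/

/-- `S(oT 1 v) ≤ (10√N_P‖v̂‖)² + E(t, 0)` for balanced capped `v` with `|v_{e,c}| ≤ t ≤ 1/30`. [cite: Luscher1983, §3] -/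
theorem wilsonAction_orthoTube_one_le {v : Edge 3 L → Fin 3 → ℝ} (hv : v ∈ capBalancedSet L) {t : ℝ} (ht : t ≤ 1 / 30) (hvt : ∀ (e : Edge 3 L) (c : Fin 3), |v e c| ≤ t) :
    wilsonAction su2Rep (orthoTube L 1 v) ≤ (10 * Real.sqrt (Fintype.card (Plaquette 3 L × Fin 3)) * ‖linkEmbed L v‖) ^ 2 + stepActionErr (L := L) t 0 := by
  have hS : (L : ℝ) ^ 3 * wilsonAction su2Rep (1 : GaugeConfig 3 1 SU2) ≤ 0 := by rw [wilsonAction_one_site_one, mul_zero]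
  have h := wilsonAction_orthoTube_le (L := L) 1 hv ht (by norm_num) hS hvt
  rw [wilsonAction_one_site_one, mul_zero, zero_add] at h
  have hD := pow_le_pow_left₀ (norm_nonneg _) (norm_covCurl_le_op (constLift L 1) (linkEmbed L v)) 2
  linarith

/-! ## §3 ★★ The pointwise floor and the one-site diagonal -/

/-- `K₁^{(L³β)}(1,1) = exp(β·2|E|)`. [folklore] -/
theorem transferKernel_one_site_one_one_cube (β : ℝ) :
    transferKernel su2Rep ((L : ℝ) ^ 3 * β) (1 : GaugeConfig 3 1 SU2) 1 = Real.exp (β * (2 * (Fintype.card (Edge 3 L) : ℝ))) := by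
  rw [← transferKernel_constLift_self_eq_one_site (L := L) β 1, transferKernel_constLift_self, wilsonAction_one_site_one, mul_zero, mul_zero, sub_zero]

/-- ★★ **Core kernel floor**: `g ∈ G_c(ρ)`, balanced capped fibres with `|v_{e,c}| ≤ t ≤ 1/30` ⇒
`K_β(oT 1 v, g·oT 1 v') ≥ exp(β·2|E| − β|E|(2ρ + √2‖v̂‖ + √2‖v̂'‖)² − β/2((10√N_P‖v̂‖)² + E(t,0) + (10√N_P‖v̂'‖)² + E(t,0)))`. [cite: Luscher1983, §3] -/
theorem transferKernel_orthoTube_one_ge {β : ℝ} (hβ : 0 ≤ β) {v v' : Edge 3 L → Fin 3 → ℝ} (hv : v ∈ capBalancedSet L) (hv' : v' ∈ capBalancedSet L) {t : ℝ} (ht : t ≤ 1 / 30)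
    (hvt : ∀ (e : Edge 3 L) (c : Fin 3), |v e c| ≤ t) (hv't : ∀ (e : Edge 3 L) (c : Fin 3), |v' e c| ≤ t) {ρ : ℝ} {g : Site 3 L → SU2} (hg : g ∈ gaugeCore L ρ) :
    Real.exp (β * (2 * (Fintype.card (Edge 3 L) : ℝ)) - β * ((Fintype.card (Edge 3 L) : ℝ) * (2 * ρ + Real.sqrt 2 * ‖linkEmbed L v‖ + Real.sqrt 2 * ‖linkEmbed L v'‖) ^ 2) -
        β / 2 * (((10 * Real.sqrt (Fintype.card (Plaquette 3 L × Fin 3)) * ‖linkEmbed L v‖) ^ 2 + stepActionErr (L := L) t 0) +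
          ((10 * Real.sqrt (Fintype.card (Plaquette 3 L × Fin 3)) * ‖linkEmbed L v'‖) ^ 2 + stepActionErr (L := L) t 0))) ≤
      transferKernel su2Rep β (orthoTube L 1 v) (gaugeTransform g (orthoTube L 1 v')) := by
  have hv1 : ∀ e : Edge 3 L, ∑ a, v e a ^ 2 ≤ 1 := sum_sq_le_one_of_cap L hv.2
  have hv'1 : ∀ e : Edge 3 L, ∑ a, v' e a ^ 2 ≤ 1 := sum_sq_le_one_of_cap L hv'.2
  rw [transferKernel_gaugeTransform_eq]
  refine Real.exp_le_exp.mpr ?_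
  have hD := kinDefect_orthoTube_one_le (L := L) hv1 hv'1 hg
  have hS := wilsonAction_orthoTube_one_le hv ht hvt
  have hS' := wilsonAction_orthoTube_one_le hv' ht hv't
  nlinarith [mul_le_mul_of_nonneg_left hD hβ, mul_le_mul_of_nonneg_left (add_le_add hS hS') (by linarith : (0 : ℝ) ≤ β / 2)]

/-! ## §4 ★★ The integrated core floor at the vacuum pair -/

/-- ★★ **Integrated core floor**: `W ≥ 𝟙_{G_c(ρ)}`, `Ω ≥ 0` supported in `{‖v̂‖ ≤ R, |v_{e,c}| ≤ t}` ⇒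
`fpBOKernel β Ω W 1 1 ≥ exp(β·2|E| − β|E|(2ρ + 2√2R)² − β((10√N_P R)² + E(t,0)))·Haar^Λ(G_c(ρ))·(∫Ω dπ)²`. [cite: Luscher1983, §3] -/
theorem fpBOKernel_one_one_ge {β : ℝ} (hβ : 0 ≤ β) {Ω : LinkSpace L → ℝ} (hΩm : Measurable Ω) {CΩ : ℝ} (hCΩ : ∀ x, |Ω x| ≤ CΩ) (hΩ0 : ∀ x, 0 ≤ Ω x)
    {W : (Site 3 L → SU2) → ℝ} (hW : Measurable W) {CW : ℝ} (hCW : ∀ g, |W g| ≤ CW) (hW0 : ∀ g, 0 ≤ W g) {ρ R t : ℝ} (hρ : 0 ≤ ρ) (ht : t ≤ 1 / 30)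
    (hWG : ∀ g ∈ gaugeCore L ρ, 1 ≤ W g)
    (hΩt : ∀ v : Edge 3 L → Fin 3 → ℝ, Ω (linkEmbed L v) ≠ 0 → (∀ (e : Edge 3 L) (c : Fin 3), |v e c| ≤ t) ∧ ‖linkEmbed L v‖ ≤ R) :
    Real.exp (β * (2 * (Fintype.card (Edge 3 L) : ℝ)) - β * ((Fintype.card (Edge 3 L) : ℝ) * (2 * ρ + 2 * Real.sqrt 2 * R) ^ 2) -
        β * ((10 * Real.sqrt (Fintype.card (Plaquette 3 L × Fin 3)) * R) ^ 2 + stepActionErr (L := L) t 0)) *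
        (gaugeMeasure L).real (gaugeCore L ρ) * (∫ v, Ω (linkEmbed L v) ∂orthoTransverse L) ^ 2 ≤ fpBOKernel L β Ω W 1 1 := by
  refine fpBOKernel_ge_of_kernel_ge β hΩm hCΩ hΩ0 hW hCW hW0 (measurableSet_gaugeCore (L := L) ρ) hWG 1 1 (Real.exp_pos _).le ?_
  intro v v' g hv hv' hΩv hΩv' hg
  obtain ⟨hvt, hvR⟩ := hΩt v hΩv
  obtain ⟨hv't, hv'R⟩ := hΩt v' hΩv'
  refine le_trans (Real.exp_le_exp.mpr ?_) (transferKernel_orthoTube_one_ge hβ hv hv' ht hvt hv't hg)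
  have hE : (0 : ℝ) ≤ Fintype.card (Edge 3 L) := Nat.cast_nonneg _
  have hN : (0 : ℝ) ≤ 10 * Real.sqrt (Fintype.card (Plaquette 3 L × Fin 3)) := by positivity
  have h2 : (0 : ℝ) ≤ Real.sqrt 2 := Real.sqrt_nonneg _
  -- monotonicity in `‖v̂‖, ‖v̂'‖ ≤ R`
  have hm : 2 * ρ + Real.sqrt 2 * ‖linkEmbed L v‖ + Real.sqrt 2 * ‖linkEmbed L v'‖ ≤ 2 * ρ + 2 * Real.sqrt 2 * R := by
    nlinarith [mul_le_mul_of_nonneg_left hvR h2, mul_le_mul_of_nonneg_left hv'R h2]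
  have hm0 : 0 ≤ 2 * ρ + Real.sqrt 2 * ‖linkEmbed L v‖ + Real.sqrt 2 * ‖linkEmbed L v'‖ := by positivity
  have hsq := pow_le_pow_left₀ hm0 hm 2
  have hq := pow_le_pow_left₀ (by positivity) (mul_le_mul_of_nonneg_left hvR hN) 2
  have hq' := pow_le_pow_left₀ (by positivity) (mul_le_mul_of_nonneg_left hv'R hN) 2
  nlinarith [mul_le_mul_of_nonneg_left hsq (mul_nonneg hβ hE), mul_le_mul_of_nonneg_left (add_le_add hq hq') hβ]

end Summit.QuantumFields.YangMills.Theorems.FemtoTransferGap.TwoLattice.ConstTube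

end
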